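import Summits.Ventures.Crystal3D.Theorems.StickyWulffConstantTextureLiminfTexShadowLevelReachMirrorCut
import Summits.Ventures.Crystal3D.Theorems.StickyWulffConstantTextureLiminfTexShadowLevelReachMulti
import HarnessLib

/-!
# MIRROR LAUNCHES, several root slots POOLED: the joint end-pair census of the (β) level lines of one interface, no relaunch term
# (lane T, crux `TextureLiminfV5`, stmt-Ventures-23912, registered stub `stub_terraceCensus`; (β) terrace census, LevelReach — T2 pooling × relaunch term)

HONEST FRAMING. Venture `Summits/Ventures/Crystal3D` (cell `crystal3d-full`), route `route-Ventures-StickyWulffConstant`, helper `--supports` the law-v5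
crux `TextureLiminfV5` (stmt-Ventures-23912), lane T, mechanism (β) (HOME/wall-p1-g19/BETA-LEDGER-RESUME-g19.md §6 T2/T3).  Census-free, certificate-free;
`KissingGap δ`, `KissingClassification δ` BY NAME as in lane F's multi-root census; nothing about energies is asserted; F-C1 not moved.

THE POINT.  `word_endPairs_multi_launch` (…TexShadowLevelReachMulti p739776) pools the typed end pairs of several root classes `r ∈ RT` over ONE base frame
into one set `T`, pairwise disjoint across roots by lane F's LEMMA X (`word_target_ne_of_roots_ne_shape`) — the shape `card_endPairs_le_of_localRow` and the
certificate consume.  Here the families are the (β) MIRROR launches of ONE interface: base frame `F [] = A′ = A − 2⟪A·, n⟫ n` (the lamella frame), roots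
`r ∈ RT` = NEAR slots of the reading frame (`⟪A r, n⟫ < 0`), launch sets `{q + A′r : q ∈ Rd r}` at located twin readings `q` of `(A, n)`, each family counted
by the relaunch-free cut census `mirrorLaunch_endPairs_cut` (…TexShadowLevelReachMirrorCut).  **`mirrorLaunch_endPairs_multi_cut`**:
`Σ_r #{q ∈ Rd r : second ball inside the window} ≤ #T + Σ_r #INV_r + #RT·(220·#rim_top + 220·#rim_bot)`, `INV_r` = inverted readings `IsTwinReading X A′ n b` in
the window reached by a root-`r` line (`P r (b, [])`, `b − A′r ∈ X`); `T` exported with end ball / predecessor / contact / window, the two-payer dichotomy,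
and per pair its root, the invariant at the end ball and an `IsEndMove` witness.  NO relaunch term.
WHAT THIS IS NOT: the supply count of the `Rd r`, the bound on the `INV_r` (assembly, T3), pooling across interfaces / letters, any certificate; F-C1 not moved.
-/

noncomputable section

namespace Summit.Ventures.Crystal3D.Cruxes.TextureLiminf.TexShadow

open Finset Summit.Ventures.Crystal3D Summit.Ventures.Crystal3D.Theorems
open scoped InnerProductSpace

variable {X : Finset (EuclideanSpace ℝ (Fin 3))}
  {F : List (EuclideanSpace ℝ (Fin 3)) → (EuclideanSpace ℝ (Fin 3) ≃ₗᵢ[ℝ] EuclideanSpace ℝ (Fin 3))}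
  {u : EuclideanSpace ℝ (Fin 3) → List (EuclideanSpace ℝ (Fin 3)) → EuclideanSpace ℝ (Fin 3)}
  {WF : EuclideanSpace ℝ (Fin 3) → List (EuclideanSpace ℝ (Fin 3)) → Prop}
  {next : List (EuclideanSpace ℝ (Fin 3)) → EuclideanSpace ℝ (Fin 3) → List (EuclideanSpace ℝ (Fin 3))}
  {P' P₂ : Finset (EuclideanSpace ℝ (Fin 3))} {R₀ h ρ : ℝ}

open scoped Classical in
/-- **The pooled end pairs of the mirror launches of one interface over several near root slots, no relaunch term.**  Hypotheses VERBATIM from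
`word_endPairs_multi_launch` (root-indexed word data `u r, WF r, P r` over one `F`, `u r [] = r`) except: the base frame is the mirror frame of the reading frame
`A` (`hA'`), the roots are near slots (`hnear`), the invariants have the predecessor property (`hPpred`) and need the cross clause only off the cut
(`κ ≠ [] ∨ m ≠ n`), and the launch sets are the mirror balls `q + F [] r` of root-indexed sets `Rd r` of twin readings of `(A, n)` that move straight (`hmov`)
and start the invariant one step later (`hP0`).  See the module docstring. -/
theorem mirrorLaunch_endPairs_multi_cut (ver : WordVersion) {δ : ℝ} (hg : KissingGap δ) (hc : KissingClassification δ)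
    (hX : ∀ p ∈ X, ∀ q ∈ X, p ≠ q → 1 ≤ dist p q)
    (hFc : ∀ μ κ, F (μ :: κ) = ((ℝ ∙ μ)ᗮ.reflection).trans (F κ))
    (RT : Finset (EuclideanSpace ℝ (Fin 3))) (hRT : ∀ r ∈ RT, r ∈ fccSlots)
    (hu0 : ∀ r ∈ RT, u r [] = r) (huc : ∀ r ∈ RT, ∀ μ κ, u r (μ :: κ) = -u r κ)
    (hWF0 : ∀ r ∈ RT, WF r [])
    (hWFc : ∀ r ∈ RT, ∀ μ κ, WF r (μ :: κ) ↔ (WF r κ ∧ ‖μ‖ = 1 ∧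
      (∀ w ∈ fccSlots, ⟪w, μ⟫_ℝ = 0 ∨ ⟪w, μ⟫_ℝ = Real.sqrt (2 / 3) ∨ ⟪w, μ⟫_ℝ = -Real.sqrt (2 / 3)) ∧
      ⟪u r κ, μ⟫_ℝ = Real.sqrt (2 / 3) ∧ ∀ μ' κ', κ = μ' :: κ' → μ' ≠ -μ))
    (hnext_pop : ∀ μ κ' (m : EuclideanSpace ℝ (Fin 3)), (F (μ :: κ')).symm m = -μ → next (μ :: κ') m = κ')
    (hnext_push : ∀ κ (m : EuclideanSpace ℝ (Fin 3)), (∀ μ κ', κ = μ :: κ' → (F κ).symm m ≠ -μ) →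
      next κ m = (F κ).symm m :: κ)
    -- the reading frame, its normal, the base frame `F []` as its mirror; the roots are NEAR slots
    (A : EuclideanSpace ℝ (Fin 3) ≃ₗᵢ[ℝ] EuclideanSpace ℝ (Fin 3)) {n : EuclideanSpace ℝ (Fin 3)}
    (hA' : ∀ x, F [] x = A x - (2 * ⟪A x, n⟫_ℝ) • n) (hnear : ∀ r ∈ RT, ⟪A r, n⟫_ℝ < 0)
    -- the root-indexed state invariants: predecessor property, preserved by legal moves off the cut, top exclusion
    {P : EuclideanSpace ℝ (Fin 3) → EuclideanSpace ℝ (Fin 3) × List (EuclideanSpace ℝ (Fin 3)) → Prop}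
    (hPpred : ∀ r ∈ RT, ∀ (b : EuclideanSpace ℝ (Fin 3)) (κ : List (EuclideanSpace ℝ (Fin 3))), WF r κ → P r (b, κ) → b - F κ (u r κ) ∈ X)
    (hPstraight : ∀ r ∈ RT, ∀ (b : EuclideanSpace ℝ (Fin 3)) (κ : List (EuclideanSpace ℝ (Fin 3))), WF r κ →
      (IsFull X (F κ) b ∨ (∃ m, IsTwinReading X (F κ) m b ∧ ⟪F κ (u r κ), m⟫_ℝ = 0) ∨
        (ver = WordVersion.v2 ∧ IsNarrow X (F κ) (F κ (u r κ)) b)) →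
      P r (b, κ) → P r (b + F κ (u r κ), κ))
    (hPcross : ∀ r ∈ RT, ∀ (b : EuclideanSpace ℝ (Fin 3)) (κ : List (EuclideanSpace ℝ (Fin 3)))
      (m : EuclideanSpace ℝ (Fin 3)), WF r κ → WF r (next κ m) → IsTwinReading X (F κ) m b →
      ⟪F κ (u r κ), m⟫_ℝ = Real.sqrt (2 / 3) → (κ ≠ [] ∨ m ≠ n) → P r (b, κ) → P r (b + F (next κ m) (u r (next κ m)), next κ m))
    (hPexcl0 : ∀ r ∈ RT, ∀ (b : EuclideanSpace ℝ (Fin 3)) (κ : List (EuclideanSpace ℝ (Fin 3))), WF r κ → P r (b, κ) →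
      b ∈ P₂ →
      (∃ a ∈ fccSlots, ∃ a' ∈ fccSlots, ∃ a'' ∈ fccSlots,
        ⟪a, a'⟫_ℝ = 1 / 2 ∧ ⟪a, a''⟫_ℝ = 1 / 2 ∧ ⟪a', a''⟫_ℝ = 1 / 2 ∧
        b + F κ a ∈ X ∧ b + F κ a' ∈ X ∧ b + F κ a'' ∈ X) → False)
    (hup : ∀ r ∈ RT, 0 < (F [] r) 2) (hR₀ : 3 ≤ R₀) (hρ : R₀ ≤ ρ)
    -- the root-indexed located READINGS of `(A, n)`: mirror balls move straight; the invariant one step later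
    (Rd : EuclideanSpace ℝ (Fin 3) → Finset (EuclideanSpace ℝ (Fin 3)))
    (hRd : ∀ r ∈ RT, ∀ q ∈ Rd r, q ∈ X ∧ IsTwinReading X A n q)
    (hmov : ∀ r ∈ RT, ∀ q ∈ Rd r, IsFull X (F []) (q + F [] r) ∨
      (∃ m, IsTwinReading X (F []) m (q + F [] r) ∧ ⟪F [] r, m⟫_ℝ = 0) ∨
      (ver = WordVersion.v2 ∧ IsNarrow X (F []) (F [] r) (q + F [] r)))
    (hP0 : ∀ r ∈ RT, ∀ q ∈ Rd r, P r (q + F [] r + F [] r, []))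
    -- the bottom plate's CORE and the top plate's sealing, verbatim
    (hP'top : ∀ p ∈ P', p 2 ≤ -R₀ - 1)
    (hstd : ∀ r ∈ RT, ∀ κ, WF r κ → ∀ p ∈ P', (∃ a ∈ fccSlots, ∃ a' ∈ fccSlots, ∃ a'' ∈ fccSlots,
        ⟪a, a'⟫_ℝ = 1 / 2 ∧ ⟪a, a''⟫_ℝ = 1 / 2 ∧ ⟪a', a''⟫_ℝ = 1 / 2 ∧
        p + F κ a ∈ X ∧ p + F κ a' ∈ X ∧ p + F κ a'' ∈ X) → F κ (u r κ) = F [] r)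
    (hsealB : ∀ s ∈ X, s ∉ P' → -R₀ - 1 - 1 ≤ s 2 → s 2 < -R₀ - 1 → s 0 ^ 2 + s 1 ^ 2 ≤ (ρ - 1) ^ 2 → False)
    (hP₂seal : ∀ s ∈ X, h + R₀ + 1 ≤ s 2 → s 2 ≤ h + R₀ + 1 + 1 → s 0 ^ 2 + s 1 ^ 2 ≤ (ρ - 2) ^ 2 → s ∈ P₂) :
    ∃ T : Finset (EuclideanSpace ℝ (Fin 3) × EuclideanSpace ℝ (Fin 3)),
      ∑ r ∈ RT, ((Rd r).filter fun q => -R₀ - 1 < (q + F [] r + F [] r) 2 ∧ (q + F [] r + F [] r) 2 < h + R₀ + 1).card ≤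
        T.card +
        ∑ r ∈ RT, (X.filter fun b => -R₀ - 1 ≤ b 2 ∧ b 2 < h + R₀ + 1 ∧ IsTwinReading X (F []) n b ∧ P r (b, []) ∧ b - F [] r ∈ X).card +
        RT.card *
          (220 * (X.filter fun s => h + R₀ + 1 ≤ s 2 ∧ s 2 ≤ h + R₀ + 1 + 1 ∧ (ρ - 2) ^ 2 < s 0 ^ 2 + s 1 ^ 2).card +
           220 * (X.filter fun s => -R₀ - 1 - 1 ≤ s 2 ∧ s 2 < -R₀ - 1 ∧ (ρ - 1) ^ 2 < s 0 ^ 2 + s 1 ^ 2).card) ∧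
      (∀ bq ∈ T, bq.1 ∈ X ∧ bq.2 ∈ X ∧ dist bq.1 bq.2 = 1 ∧ -R₀ - 1 ≤ bq.1 2 ∧ bq.1 2 < h + R₀ + 1) ∧
      (∀ bq ∈ T, (X.filter fun q => dist bq.1 q = 1).card ≤ 11 ∨
        ∃ z₁ ∈ X, ∃ z₂ ∈ X, z₁ ≠ z₂ ∧ dist bq.1 z₁ = 1 ∧ dist bq.1 z₂ = 1 ∧
          (X.filter fun q => dist z₁ q = 1).card ≤ 11 ∧ (X.filter fun q => dist z₂ q = 1).card ≤ 11) ∧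
      (∀ bq ∈ T, ∃ r ∈ RT, (∃ κ, WF r κ ∧ P r (bq.1, κ)) ∧
        ∃ κ, WF r κ ∧ bq.2 - F κ (u r κ) ∈ X ∧ IsEndMove X ver (F κ) (F κ (u r κ)) bq.2 bq.1) := by
  set RIM : ℕ :=
    220 * (X.filter fun s => h + R₀ + 1 ≤ s 2 ∧ s 2 ≤ h + R₀ + 1 + 1 ∧ (ρ - 2) ^ 2 < s 0 ^ 2 + s 1 ^ 2).card +
      220 * (X.filter fun s => -R₀ - 1 - 1 ≤ s 2 ∧ s 2 < -R₀ - 1 ∧ (ρ - 1) ^ 2 < s 0 ^ 2 + s 1 ^ 2).card with hRIM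
  -- the per-root located inverted readings
  set INV : EuclideanSpace ℝ (Fin 3) → ℕ := fun r =>
    (X.filter fun b => -R₀ - 1 ≤ b 2 ∧ b 2 < h + R₀ + 1 ∧ IsTwinReading X (F []) n b ∧ P r (b, []) ∧ b - F [] r ∈ X).card with hINV
  -- the per-family end pairs, each family with its own invariant `P r` and its own reading set `Rd r`
  have hfam : ∀ r ∈ RT, ∃ T : Finset (EuclideanSpace ℝ (Fin 3) × EuclideanSpace ℝ (Fin 3)),
      ((Rd r).filter fun q => -R₀ - 1 < (q + F [] r + F [] r) 2 ∧ (q + F [] r + F [] r) 2 < h + R₀ + 1).card ≤ T.card + INV r + RIM ∧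
      (∀ bq ∈ T, bq.1 ∈ X ∧ bq.2 ∈ X ∧ dist bq.1 bq.2 = 1 ∧ -R₀ - 1 ≤ bq.1 2 ∧ bq.1 2 < h + R₀ + 1) ∧
      (∀ bq ∈ T, (X.filter fun q => dist bq.1 q = 1).card ≤ 11 ∨
        ∃ z₁ ∈ X, ∃ z₂ ∈ X, z₁ ≠ z₂ ∧ dist bq.1 z₁ = 1 ∧ dist bq.1 z₂ = 1 ∧
          (X.filter fun q => dist z₁ q = 1).card ≤ 11 ∧ (X.filter fun q => dist z₂ q = 1).card ≤ 11) ∧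
      (∀ bq ∈ T, ∃ κ, WF r κ ∧ P r (bq.1, κ)) ∧
      (∀ bq ∈ T, ∃ κ, WF r κ ∧ bq.2 - F κ (u r κ) ∈ X ∧ IsEndMove X ver (F κ) (F κ (u r κ)) bq.2 bq.1) := by
    intro r hr
    have hur : ∀ κ, u r κ ∈ fccSlots := word_u_mem (hRT r hr) (hu0 r hr) (huc r hr)
    have hup' : 0 < (F [] (u r [])) 2 := by rw [hu0 r hr]; exact hup r hr
    have hnear' : ⟪A (u r []), n⟫_ℝ < 0 := by rw [hu0 r hr]; exact hnear r hr
    have hmov' : ∀ q ∈ Rd r, IsFull X (F []) (q + F [] (u r [])) ∨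
        (∃ m, IsTwinReading X (F []) m (q + F [] (u r [])) ∧ ⟪F [] (u r []), m⟫_ℝ = 0) ∨
        (ver = WordVersion.v2 ∧ IsNarrow X (F []) (F [] (u r [])) (q + F [] (u r []))) := by rw [hu0 r hr]; exact hmov r hr
    have hP0' : ∀ q ∈ Rd r, P r (q + F [] (u r []) + F [] (u r []), []) := by rw [hu0 r hr]; exact hP0 r hr
    have hstd' : ∀ κ, WF r κ → ∀ p ∈ P', (∃ a ∈ fccSlots, ∃ a' ∈ fccSlots, ∃ a'' ∈ fccSlots,
        ⟪a, a'⟫_ℝ = 1 / 2 ∧ ⟪a, a''⟫_ℝ = 1 / 2 ∧ ⟪a', a''⟫_ℝ = 1 / 2 ∧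
        p + F κ a ∈ X ∧ p + F κ a' ∈ X ∧ p + F κ a'' ∈ X) → F κ (u r κ) = F [] (u r []) := by
      rw [hu0 r hr]; exact hstd r hr
    obtain ⟨T, hkey, hT, hpay, hinv, hwit⟩ := mirrorLaunch_endPairs_cut ver (F := F) (u := u r) (WF := WF r)
      (next := next) (P := P r) hg hc hX hFc hur (huc r hr) (hWF0 r hr) (hWFc r hr) hnext_pop hnext_push A hA' hnear'
      (hPpred r hr) (hPstraight r hr) (hPcross r hr) (hPexcl0 r hr) hup' hR₀ hρ (Rd r) (hRd r hr) hmov' hP0' hP'top hstd' hsealB hP₂seal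
    rw [hu0 r hr] at hkey
    exact ⟨T, by rw [hINV, hRIM]; linarith [hkey], hT, hpay, hinv, hwit⟩
  choose! Tf hTkey hTpair hTpay hTinv hTwit using hfam
  -- pairwise disjointness across roots: LEMMA X (shape form)
  have hdisj : ∀ r ∈ RT, ∀ r' ∈ RT, r ≠ r' → Disjoint (Tf r) (Tf r') := by
    intro r hr r' hr' hrr'
    rw [Finset.disjoint_left]
    intro bq hbq hbq'
    obtain ⟨κ, hκ, -, hmove⟩ := hTwit r hr bq hbq
    obtain ⟨κ', hκ', -, hmove'⟩ := hTwit r' hr' bq hbq'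
    obtain ⟨hlet, hch⟩ := word_letters_of_wf (huc r hr) (hWFc r hr) κ hκ
    obtain ⟨hlet', hch'⟩ := word_letters_of_wf (huc r' hr') (hWFc r' hr') κ' hκ'
    have hob := word_letters_oblique_of_wf (huc r hr) (hWFc r hr) κ hκ
    have hob' := word_letters_oblique_of_wf (huc r' hr') (hWFc r' hr') κ' hκ'
    rw [hu0 r hr] at hob
    rw [hu0 r' hr'] at hob'
    have hne' : r ≠ -r' := by
      intro h
      have h1 := hup r hr
      have h2 := hup r' hr'
      rw [h, map_neg, PiLp.neg_apply] at h1
      linarith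
    have hd : F κ (u r κ) = F κ (((-1 : ℝ) ^ κ.length) • r) := by rw [word_u_eq_pow (huc r hr) κ, hu0 r hr]
    have hd' : F κ' (u r' κ') = F κ' (((-1 : ℝ) ^ κ'.length) • r') := by
      rw [word_u_eq_pow (huc r' hr') κ', hu0 r' hr']
    exact word_target_ne_of_roots_ne_shape hFc hlet hlet' hch hch' (hRT r hr) (hRT r' hr') hrr' hne' hob hob'
      (neg_one_pow_eq_or ℝ κ.length) (neg_one_pow_eq_or ℝ κ'.length) hd hd'
      (shape_of_isEndMove hmove) (shape_of_isEndMove hmove') rfl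
  -- export the pooled pair set
  refine ⟨RT.biUnion Tf, ?_, ?_, ?_, ?_⟩
  · rw [card_biUnion hdisj]
    calc ∑ r ∈ RT, ((Rd r).filter fun q => -R₀ - 1 < (q + F [] r + F [] r) 2 ∧ (q + F [] r + F [] r) 2 < h + R₀ + 1).card
        ≤ ∑ r ∈ RT, ((Tf r).card + INV r + RIM) := sum_le_sum fun r hr => hTkey r hr
      _ = ∑ r ∈ RT, (Tf r).card + ∑ r ∈ RT, INV r + RT.card * RIM := by
          rw [sum_add_distrib, sum_add_distrib, sum_const, smul_eq_mul]
      _ ≤ _ := by rw [hINV, hRIM]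
  · intro bq hbq
    obtain ⟨r, hr, hbqr⟩ := mem_biUnion.1 hbq
    exact hTpair r hr bq hbqr
  · intro bq hbq
    obtain ⟨r, hr, hbqr⟩ := mem_biUnion.1 hbq
    exact hTpay r hr bq hbqr
  · intro bq hbq
    obtain ⟨r, hr, hbqr⟩ := mem_biUnion.1 hbq
    exact ⟨r, hr, hTinv r hr bq hbqr, hTwit r hr bq hbqr⟩

end Summit.Ventures.Crystal3D.Cruxes.TextureLiminf.TexShadow

end
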